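import Literature.Geometry.Lorentzian.MinkowskiCauchyDevelopment
import Literature.Geometry.Lorentzian.TrappedSurface
import Literature.Geometry.Lorentzian.SecondFundamentalFormApply
import Literature.Geometry.Lorentzian.IsometryProofs
import Literature.Geometry.Lorentzian.EinsteinProofs
import Literature.Geometry.Riemannian.EuclideanHypersurfaceContact
import Mathlib.Geometry.Manifold.Instances.Sphere
import HarnessLib

/-!
# Crux `HorizonlessMustDrain` (stmt-FinalStateConjecture-9976), sanity tier — stub S5:
# the null expansions of the round sections of the light cone of Minkowski spacetime

Line `Cruxes/HorizonlessMustDrain/Lines/birth.lean` builds the first inhabitant of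
`CauchyDevelopment.HasVanishingFinalBondiMass` in the Minkowski development
`Literature.Geometry.Lorentzian.Minkowski.vacuumCauchyDevelopment` (carrier `E4`, metric
`Minkowski.smoothMetric`, `smoothMetric_val x = η` by `rfl`) out of the round sections
`S_r = {(r, r y) : y ∈ S²}` of the future light cone of the origin.  This file proves the registered
stub `stub_minkowskiSectionNullExpansion` (S5 of that line): for `r > 0`, for ANY null normal pair
`(L, L̲)` of the section `y ↦ (r, r y)` with the values `L = (1, y)`, `L̲ = (1, -y)`, the null
expansions (`LorentzianMetric.nullExpansion`: the trace over the induced metric of the null second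
fundamental form `χ_L(v, w) = η(D_v L, df w)`, sign convention (h) of `Hypersurface.lean`) are
`θ_L = 2/r` and `θ_L̲ = -2/r`.

## The argument (Hawking–Ellis 1973, §4.2; O'Neill 1983, Ch. 3, Lemma 3.14 and Prop. 3.18,
## Ch. 4, Lemma 4.27)

* The Levi-Civita connection of a metric with constant components on a vector space kills the
  constant coordinate frame (`ModelSpace.leviCivita_const`, O'Neill's Lemma 3.14), so in the frame
  formula `DW/dt = ∑ (cⁱ)' bᵢ + ∑ cⁱ ∇_{γ'} bᵢ` (`covariantDerivAlong`, Prop. 3.18) only the first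
  sum survives: **the covariant derivative along a curve is the ordinary derivative**
  (`covariantDerivAlong_eq_of_hasDerivAt`; the Euclidean case is
  `EuclideanHypersurface.covariantDerivAlong_eq_of_hasDerivAt`, whose proof is adapted verbatim).
* Hence for the field `L_s(y) = (1, s y)` along the section `f(y) = (r, r y)` the covariant
  derivative in the direction `v ∈ T_y S²` is `D_v L_s = s (0, dι v)` (`dι` the differential of the
  inclusion `S² ⊆ E3`), while `df v = r (0, dι v)`; so
  `χ_{L_s}(v, w) = η(s (0, dι v), r (0, dι w)) = (s/r) · η(df v, df w) = (s/r) (f^*η)(v, w)`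
  (`secondFundamentalForm_apply_holds` at the interior point `y` of the boundaryless sphere):
  the sections are totally umbilic, `χ_{L_s} = (s/r) γ` (`secondFundamentalForm_section_eq_smul`).
* The metric trace of `c · γ` over `γ` is `c · dim = 2c` (`trace_smul`, `trace_toBilinForm_eq`), so
  `θ_{L_s} = 2s/r` (`nullExpansion_section`); `s = 1` and `s = -1` give the stub.

Everything is proved; no named fact is used.  Helper lemmas live in the sub-namespace
`…BondiDrainDispersalHorizonlessMustDrain.StubMinkowskiSectionNullExpansion`.  The statements about
the development's metric (typed over the model `𝓡 (3 + 1)` and the carrier of the bundled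
spacetime) are definitionally those about `Minkowski.smoothMetric` over `𝓘(ℝ, E4)`; the final proof
converts by `rfl` (the Levi-Civita instance is re-registered in the `smoothMetric` form, as in
`KissingBallsCutMass.lean`).

## References

* S. W. Hawking, G. F. R. Ellis, *The large scale structure of space-time*, CUP 1973, §4.2
  (null second fundamental forms and expansions). [HawkingEllis1973]
* B. O'Neill, *Semi-Riemannian geometry with applications to relativity*, Academic Press 1983,
  Ch. 3, Lemma 3.14, Prop. 3.18; Ch. 4, Lemma 4.1, Lemma 4.27 (spheres are totally umbilic).
  [ONeill1983]
-/

noncomputable section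

open Bundle Set Function Metric Module
open scoped Manifold ContDiff Topology
open Literature.Geometry.Lorentzian Literature.Geometry.Lorentzian.Minkowski

namespace Summit.FinalStateConjecture.FinalStateConjecture.Theorems.BondiDrainDispersalHorizonlessMustDrain

-- D-0017: single-problem summit, `Summit.<S>.<S>.…` by design.
set_option linter.dupNamespace false

namespace StubMinkowskiSectionNullExpansion

/-! ### The flat covariant derivative along a curve (metric with constant components) -/

section ModelSpace

variable {F : Type*} [NormedAddCommGroup F] [NormedSpace ℝ F] [FiniteDimensional ℝ F] {n : ℕ∞ω}
  {g : PseudoRiemannianMetric 𝓘(ℝ, F) n F (TangentSpace 𝓘(ℝ, F) : F → Type _)}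
  {G₀ : F →L[ℝ] F →L[ℝ] ℝ}

/-- **The covariant derivative along a curve is the ordinary derivative, for a metric with constant
components on a vector space**: if `g_y = G₀` for all `y : F`, then for every curve `γ` of `F` and
every field `V` along it (a curve of `F`) with `V'(t₀) = V'`, `DV/dt (t₀) = V'` — in the frame
formula `∑ᵢ (cⁱ)' bᵢ + ∑ᵢ cⁱ ∇_{γ'} bᵢ` the coordinate frame is constant
(`ModelSpace.localFrame_trivializationAt`) and parallel (`ModelSpace.leviCivita_const`). The
Euclidean case is `EuclideanHypersurface.covariantDerivAlong_eq_of_hasDerivAt` (proof adapted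
verbatim). O'Neill 1983, Ch. 3, Lemma 3.14 and Prop. 3.18. [cite: ONeill1983, Ch. 3, Prop. 3.18] -/
theorem covariantDerivAlong_eq_of_hasDerivAt [g.HasLeviCivita] (hG : ∀ y : F, g.val y = G₀)
    {γ : ℝ → F} {V : ℝ → F} {t₀ : ℝ} {V' : F} (hV : HasDerivAt V V' t₀) :
    covariantDerivAlong g.leviCivita γ V t₀ = V' := by
  -- adapted from
  -- `Literature.Geometry.Riemannian.EuclideanHypersurface.covariantDerivAlong_eq_of_hasDerivAt`
  rw [covariantDerivAlong_def]
  simp only [covariantDerivAlongFrame, ModelSpace.localFrame_trivializationAt,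
    ModelSpace.localFrame_coeff_trivializationAt, ModelSpace.leviCivita_const hG,
    zero_apply, smul_zero, Finset.sum_const_zero, add_zero]
  set b := Module.finBasis ℝ F
  have h : ∀ i, deriv (fun t ↦ b.repr (V t) i) t₀ = b.repr V' i := fun i ↦ by
    have hL : HasDerivAt (fun t ↦ (b.coord i) (V t)) ((b.coord i) V') t₀ :=
      ((LinearMap.toContinuousLinearMap (b.coord i)).hasFDerivAt).comp_hasDerivAt t₀ hV
    exact hL.deriv
  simp_rw [h]
  exact b.sum_repr V'

end ModelSpace

/-! ### Calculus of the maps `y ↦ (a, s y)` on the unit sphere of `E3` -/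

/-- `(a, s x) = (a, 0) + s (0, x)` in `E4` (coordinatewise). [folklore] -/
theorem ofTimeSpace_smul_eq (a s : ℝ) (x : E3) :
    E4.ofTimeSpace a (s • x) = E4.ofTimeSpace a 0 + s • E4.ofTimeSpace 0 x := by
  ext i
  refine Fin.cases ?_ (fun j ↦ ?_) i <;> simp

/-- **Derivative of `t ↦ (a, s u(t))`**: if `u'(t) = u'` then the `E4`-valued curve
`t ↦ (a, s u(t))` has derivative `s (0, u')` (the map `x ↦ (0, x)` is linear,
`Minkowski.isLinearMap_ofTimeSpace_zero`). [folklore] -/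
theorem hasDerivAt_ofTimeSpace_smul {u : ℝ → E3} {u' : E3} {t : ℝ} (hu : HasDerivAt u u' t)
    (a s : ℝ) :
    HasDerivAt (fun t ↦ E4.ofTimeSpace a (s • u t)) (s • E4.ofTimeSpace 0 u') t := by
  set L₀ : E3 →L[ℝ] E4 :=
    LinearMap.toContinuousLinearMap (IsLinearMap.mk' _ isLinearMap_ofTimeSpace_zero)
  have h1 : HasDerivAt (fun t ↦ L₀ (u t)) (L₀ u') t := L₀.hasFDerivAt.comp_hasDerivAt t hu
  have h2 := (h1.const_smul s).const_add (E4.ofTimeSpace a 0)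
  have hfun : (fun t ↦ E4.ofTimeSpace a (s • u t)) = fun t ↦ E4.ofTimeSpace a 0 + s • L₀ (u t) :=
    funext fun t ↦ ofTimeSpace_smul_eq a s (u t)
  rw [hfun]
  exact h2

/-- **The differential of `y ↦ (a, s y)` on the sphere** is `w ↦ s (0, dι w)`, `dι` the
differential of the inclusion `S² ⊆ E3` (chain rule: the map is the affine map `x ↦ (a, s x)` of
`E3` restricted to the sphere, Mathlib's `contMDiff_coe_sphere`). [folklore] -/
theorem hasMFDerivAt_ofTimeSpace_smul_coe (a s : ℝ) (y : sphere (0 : E3) 1) :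
    ∃ D : TangentSpace (𝓡 2) y →L[ℝ] E4,
      HasMFDerivAt (𝓡 2) 𝓘(ℝ, E4)
          (fun y : sphere (0 : E3) 1 ↦ E4.ofTimeSpace a (s • (y : E3))) y D ∧
        ∀ w, D w = s • E4.ofTimeSpace 0
          (show E3 from mfderiv (𝓡 2) 𝓘(ℝ, E3) (Subtype.val : sphere (0 : E3) 1 → E3) y w) := by
  -- `dim E3 = 2 + 1`: the `Fact` through which Mathlib's sphere API sees `S² ⊆ E3`
  haveI : Fact (finrank ℝ E3 = 2 + 1) := ⟨finrank_euclideanSpace_fin⟩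
  set L₀ : E3 →L[ℝ] E4 :=
    LinearMap.toContinuousLinearMap (IsLinearMap.mk' _ isLinearMap_ofTimeSpace_zero)
  have hF : HasFDerivAt (fun x : E3 ↦ E4.ofTimeSpace a (s • x)) (s • L₀) (y : E3) := by
    have h := ((L₀.hasFDerivAt (x := (y : E3))).const_smul s).const_add (E4.ofTimeSpace a 0)
    have hfun : (fun x : E3 ↦ E4.ofTimeSpace a (s • x)) =
        fun x ↦ E4.ofTimeSpace a 0 + s • L₀ x :=
      funext fun x ↦ ofTimeSpace_smul_eq a s x
    rw [hfun]
    exact h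
  have hval : MDifferentiableAt (𝓡 2) 𝓘(ℝ, E3) (Subtype.val : sphere (0 : E3) 1 → E3) y :=
    (contMDiff_coe_sphere (m := 1) (n := 2) y).mdifferentiableAt one_ne_zero
  exact ⟨(s • L₀).comp (mfderiv (𝓡 2) 𝓘(ℝ, E3) (Subtype.val : sphere (0 : E3) 1 → E3) y),
    hF.hasMFDerivAt.comp y hval.hasMFDerivAt, fun w ↦ rfl⟩

/-- `y ↦ (a, s y)` is differentiable on the sphere. [folklore] -/
theorem mdifferentiableAt_ofTimeSpace_smul_coe (a s : ℝ) (y : sphere (0 : E3) 1) :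
    MDifferentiableAt (𝓡 2) 𝓘(ℝ, E4)
      (fun y : sphere (0 : E3) 1 ↦ E4.ofTimeSpace a (s • (y : E3))) y := by
  obtain ⟨D, hD, -⟩ := hasMFDerivAt_ofTimeSpace_smul_coe a s y
  exact hD.mdifferentiableAt

/-- `d(y ↦ (a, s y))_y w = s (0, dι_y w)` on the sphere. [folklore] -/
theorem mfderiv_ofTimeSpace_smul_coe (a s : ℝ) (y : sphere (0 : E3) 1)
    (w : TangentSpace (𝓡 2) y) :
    mfderiv (𝓡 2) 𝓘(ℝ, E4) (fun y : sphere (0 : E3) 1 ↦ E4.ofTimeSpace a (s • (y : E3))) y w =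
      s • E4.ofTimeSpace 0
        (show E3 from mfderiv (𝓡 2) 𝓘(ℝ, E3) (Subtype.val : sphere (0 : E3) 1 → E3) y w) := by
  obtain ⟨D, hD, hDw⟩ := hasMFDerivAt_ofTimeSpace_smul_coe a s y
  rw [hD.mfderiv]
  exact hDw w

/-! ### The null second fundamental forms and null expansions of the sections `y ↦ (r, r y)` -/

/-- **`D_v L_s = s (0, dι v)`**: the covariant derivative (Levi-Civita connection of `η`) of the
field `L_s(y) = (1, s y)` along the section `y ↦ (r, r y)` in the direction `v ∈ T_y S²` is the
ordinary derivative of `t ↦ (1, s c(t))` along the chart-straight curve `c` through `y` with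
velocity `v` (`covariantDerivAlong_eq_of_hasDerivAt` with `smoothMetric_val`;
`EuclideanHypersurface.hasDerivAt_comp_curveThrough_zero`). O'Neill 1983, Ch. 4, Lemma 4.1 (flat
case). [cite: ONeill1983, Ch. 4, Lemma 4.1] -/
theorem normalDerivAlong_section [smoothMetric.toPseudoRiemannianMetric.HasLeviCivita] (r s : ℝ)
    (y : sphere (0 : E3) 1) (v : TangentSpace (𝓡 2) y) :
    smoothMetric.toPseudoRiemannianMetric.normalDerivAlong
        (fun y : sphere (0 : E3) 1 ↦ E4.ofTimeSpace r (r • (y : E3)))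
        (fun y : sphere (0 : E3) 1 ↦ E4.ofTimeSpace 1 (s • (y : E3))) y v =
      s • E4.ofTimeSpace 0
        (show E3 from mfderiv (𝓡 2) 𝓘(ℝ, E3) (Subtype.val : sphere (0 : E3) 1 → E3) y v) := by
  -- `dim E3 = 2 + 1`: the `Fact` through which Mathlib's sphere API sees `S² ⊆ E3`
  haveI : Fact (finrank ℝ E3 = 2 + 1) := ⟨finrank_euclideanSpace_fin⟩
  have hc : HasDerivAt ((Subtype.val : sphere (0 : E3) 1 → E3) ∘ curveThrough (𝓡 2) y v)
      (show E3 from mfderiv (𝓡 2) 𝓘(ℝ, E3) (Subtype.val : sphere (0 : E3) 1 → E3) y v) 0 :=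
    Literature.Geometry.Riemannian.EuclideanHypersurface.hasDerivAt_comp_curveThrough_zero
      (contMDiff_coe_sphere (n := 2)) y v
  exact covariantDerivAlong_eq_of_hasDerivAt (g := smoothMetric.toPseudoRiemannianMetric)
    smoothMetric_val (hasDerivAt_ofTimeSpace_smul hc 1 s)

/-- **`χ_{L_s}(v, w) = (s/r) (f^*η)(v, w)`** for the section `f(y) = (r, r y)`, `r ≠ 0`, and the
field `L_s(y) = (1, s y)`: `χ_{L_s}(v, w) = η(D_v L_s, df w) = η(s (0, dι v), r (0, dι w))` and
`(f^*η)(v, w) = η(r (0, dι v), r (0, dι w))` (`secondFundamentalForm_apply_holds` at the interior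
point `y` of the boundaryless sphere, `normalDerivAlong_section`, `mfderiv_ofTimeSpace_smul_coe`).
Hawking–Ellis 1973, §4.2; O'Neill 1983, Ch. 4, Lemma 4.27 (spheres are totally umbilic).
[cite: HawkingEllis1973, §4.2] -/
theorem secondFundamentalForm_section_apply [smoothMetric.toPseudoRiemannianMetric.HasLeviCivita]
    {r : ℝ} (hr : r ≠ 0) (s : ℝ) (y : sphere (0 : E3) 1) (v w : TangentSpace (𝓡 2) y) :
    smoothMetric.toPseudoRiemannianMetric.secondFundamentalForm (𝓡 2)
        (fun y : sphere (0 : E3) 1 ↦ E4.ofTimeSpace r (r • (y : E3)))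
        (fun y : sphere (0 : E3) 1 ↦ E4.ofTimeSpace 1 (s • (y : E3))) y v w =
      (s * r⁻¹) * smoothMetric.toPseudoRiemannianMetric.inducedBilin (𝓡 2)
        (fun y : sphere (0 : E3) 1 ↦ E4.ofTimeSpace r (r • (y : E3))) y v w := by
  have hlift : MDifferentiableAt (𝓡 2) 𝓘(ℝ, E4).tangent
      (fun x : sphere (0 : E3) 1 ↦ (TotalSpace.mk' E4 (E4.ofTimeSpace r (r • (x : E3)))
        (E4.ofTimeSpace 1 (s • (x : E3))) : TangentBundle 𝓘(ℝ, E4) E4)) y :=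
    Literature.Geometry.Riemannian.EuclideanHypersurface.mdifferentiableAt_lift
      (mdifferentiableAt_ofTimeSpace_smul_coe r r y) (mdifferentiableAt_ofTimeSpace_smul_coe 1 s y)
  -- the tangent images `(0, dι v)`, `(0, dι w)` as honest elements of `E4`
  set Tv : E4 := E4.ofTimeSpace 0
    (show E3 from mfderiv (𝓡 2) 𝓘(ℝ, E3) (Subtype.val : sphere (0 : E3) 1 → E3) y v)
  set Tw : E4 := E4.ofTimeSpace 0
    (show E3 from mfderiv (𝓡 2) 𝓘(ℝ, E3) (Subtype.val : sphere (0 : E3) 1 → E3) y w)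
  have hK : smoothMetric.toPseudoRiemannianMetric.secondFundamentalForm (𝓡 2)
      (fun y : sphere (0 : E3) 1 ↦ E4.ofTimeSpace r (r • (y : E3)))
      (fun y : sphere (0 : E3) 1 ↦ E4.ofTimeSpace 1 (s • (y : E3))) y v w =
        bilin (s • Tv) (r • Tw) := by
    rw [PseudoRiemannianMetric.secondFundamentalForm_apply_holds (I' := 𝓡 2)
        (g := smoothMetric.toPseudoRiemannianMetric) BoundarylessManifold.isInteriorPoint hlift v w,
      normalDerivAlong_section r s y v, mfderiv_ofTimeSpace_smul_coe r r y w]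
    rfl
  have hI : smoothMetric.toPseudoRiemannianMetric.inducedBilin (𝓡 2)
      (fun y : sphere (0 : E3) 1 ↦ E4.ofTimeSpace r (r • (y : E3))) y v w =
        bilin (r • Tv) (r • Tw) := by
    rw [PseudoRiemannianMetric.inducedBilin_apply, mfderiv_ofTimeSpace_smul_coe r r y v,
      mfderiv_ofTimeSpace_smul_coe r r y w]
    rfl
  rw [hK, hI]
  simp only [map_smul, smul_apply, smul_eq_mul]
  field_simp

/-- **The sections are totally umbilic: `χ_{L_s} = (s/r) · (f^*η)`** as bilinear forms on
`T_y S²`, `f(y) = (r, r y)`, `L_s(y) = (1, s y)`, `r ≠ 0` (`secondFundamentalForm_section_apply`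
on all pairs of vectors). O'Neill 1983, Ch. 4, Lemma 4.27; Hawking–Ellis 1973, §4.2.
[cite: ONeill1983, Ch. 4, Lemma 4.27] -/
theorem secondFundamentalForm_section_eq_smul [smoothMetric.toPseudoRiemannianMetric.HasLeviCivita]
    {r : ℝ} (hr : r ≠ 0) (s : ℝ)
    (hf : smoothMetric.toPseudoRiemannianMetric.IsSpacelikeImmersion (𝓡 2)
      (fun y : sphere (0 : E3) 1 ↦ E4.ofTimeSpace r (r • (y : E3))))
    (y : sphere (0 : E3) 1) :
    smoothMetric.toPseudoRiemannianMetric.secondFundamentalForm (𝓡 2)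
        (fun y : sphere (0 : E3) 1 ↦ E4.ofTimeSpace r (r • (y : E3)))
        (fun y : sphere (0 : E3) 1 ↦ E4.ofTimeSpace 1 (s • (y : E3))) y =
      (s * r⁻¹) • (smoothMetric.toPseudoRiemannianMetric.inducedMetric
        (fun y : sphere (0 : E3) 1 ↦ E4.ofTimeSpace r (r • (y : E3)))
        PseudoRiemannianMetric.contMDiff_pullbackBilin_holds hf).toBilinForm y := by
  refine LinearMap.ext fun v ↦ LinearMap.ext fun w ↦ ?_
  rw [LinearMap.smul_apply, LinearMap.smul_apply, smul_eq_mul,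
    PseudoRiemannianMetric.toBilinForm_apply, PseudoRiemannianMetric.inducedMetric_val,
    secondFundamentalForm_section_apply hr s y v w]

/-- **`θ_{L_s} = 2s/r`**: the null expansion of the section `f(y) = (r, r y)` of Minkowski
spacetime (`r ≠ 0`) with respect to any field `L` along `f` with the values `L(y) = (1, s y)` is
`2s/r` — the trace over the induced metric `γ = f^*η` of `χ_L = (s/r) γ` is `(s/r) · dim S² = 2s/r`
(`secondFundamentalForm_section_eq_smul`, `PseudoRiemannianMetric.trace_smul`,
`PseudoRiemannianMetric.trace_toBilinForm_eq`). Hawking–Ellis 1973, §4.2 (`θ = χ^a{}_a`); for a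
round sphere of radius `r` in a flat slice `θ± = ±2/r`. [cite: HawkingEllis1973, §4.2] -/
theorem nullExpansion_section [smoothMetric.toPseudoRiemannianMetric.HasLeviCivita]
    {r : ℝ} (hr : r ≠ 0) (s : ℝ)
    (hf : smoothMetric.toPseudoRiemannianMetric.IsSpacelikeImmersion (𝓡 2)
      (fun y : sphere (0 : E3) 1 ↦ E4.ofTimeSpace r (r • (y : E3))))
    {L : sphere (0 : E3) 1 → E4} (hL : ∀ y, L y = E4.ofTimeSpace 1 (s • (y : E3)))
    (y : sphere (0 : E3) 1) :
    smoothMetric.nullExpansion (fun y : sphere (0 : E3) 1 ↦ E4.ofTimeSpace r (r • (y : E3)))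
      PseudoRiemannianMetric.contMDiff_pullbackBilin_holds hf L y = 2 * s / r := by
  obtain rfl : L = fun y : sphere (0 : E3) 1 ↦ E4.ofTimeSpace 1 (s • (y : E3)) := funext hL
  rw [LorentzianMetric.nullExpansion, LorentzianMetric.nullSecondFundamentalForm_eq,
    secondFundamentalForm_section_eq_smul hr s hf y, PseudoRiemannianMetric.trace_smul,
    PseudoRiemannianMetric.trace_toBilinForm_eq, finrank_euclideanSpace_fin]
  push_cast
  field_simp

end StubMinkowskiSectionNullExpansion

open StubMinkowskiSectionNullExpansion in
/-- **S5 — THE NULL EXPANSIONS OF THE SECTION OF RADIUS `r` ARE `θ_L = 2/r`, `θ_L̲ = -2/r`** for the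
null normal pair `L = (1, y)`, `L̲ = (1, -y)` of the round section `y ↦ (r, r y)`, `r > 0`, of the
light cone of the origin of the Minkowski development (any pair with these values; the expansions
depend on the values only).  The Levi-Civita connection of `η` is the flat one, so the covariant
derivative of `L = (1, y)` along the section in a tangent direction `v` is `(0, dι v) = r⁻¹ df(v)`:
the null second fundamental forms are `χ_L = r⁻¹ γ`, `χ_L̲ = -r⁻¹ γ` (`γ` the induced metric) and
their traces over the `2`-dimensional induced metric are `±2/r` (`nullExpansion_section` with
`s = ±1`; the statement over the development's metric, model `𝓡 (3 + 1)`, is definitionally the one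
over `Minkowski.smoothMetric`, model `𝓘(ℝ, E4)`).  Hawking–Ellis 1973, §4.2; O'Neill 1983, Ch. 4,
Lemma 4.27. [cite: HawkingEllis1973, §4.2] -/
theorem stub_minkowskiSectionNullExpansion : open scoped Manifold in
    ∀ r : ℝ, 0 < r →
      ∀ [Literature.Geometry.Lorentzian.Minkowski.vacuumCauchyDevelopment.toCauchyDevelopment.metric.HasLeviCivita]
        (hf : Literature.Geometry.Lorentzian.Minkowski.vacuumCauchyDevelopment.toCauchyDevelopment.metric.IsSpacelikeImmersion
          (𝓡 2) (fun y : Metric.sphere (0 : Literature.Geometry.Lorentzian.E3) 1 ↦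
            Literature.Geometry.Lorentzian.E4.ofTimeSpace r (r • (y : Literature.Geometry.Lorentzian.E3))))
        (P : Literature.Geometry.Lorentzian.LorentzianMetric.NullNormalPair (𝓡 2)
          Literature.Geometry.Lorentzian.Minkowski.vacuumCauchyDevelopment.toCauchyDevelopment.metric
          Literature.Geometry.Lorentzian.Minkowski.vacuumCauchyDevelopment.toCauchyDevelopment.timeOrientation
          (fun y : Metric.sphere (0 : Literature.Geometry.Lorentzian.E3) 1 ↦
            Literature.Geometry.Lorentzian.E4.ofTimeSpace r (r • (y : Literature.Geometry.Lorentzian.E3)))),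
        (∀ y, P.L y = Literature.Geometry.Lorentzian.E4.ofTimeSpace 1 (y : Literature.Geometry.Lorentzian.E3)) →
        (∀ y, P.Lbar y = Literature.Geometry.Lorentzian.E4.ofTimeSpace 1 (-(y : Literature.Geometry.Lorentzian.E3))) →
        ∀ y : Metric.sphere (0 : Literature.Geometry.Lorentzian.E3) 1,
          Literature.Geometry.Lorentzian.Minkowski.vacuumCauchyDevelopment.toCauchyDevelopment.metric.nullExpansion
              (fun y : Metric.sphere (0 : Literature.Geometry.Lorentzian.E3) 1 ↦
                Literature.Geometry.Lorentzian.E4.ofTimeSpace r (r • (y : Literature.Geometry.Lorentzian.E3)))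
              Literature.Geometry.Lorentzian.PseudoRiemannianMetric.contMDiff_pullbackBilin_holds hf P.L y = 2 / r ∧
          Literature.Geometry.Lorentzian.Minkowski.vacuumCauchyDevelopment.toCauchyDevelopment.metric.nullExpansion
              (fun y : Metric.sphere (0 : Literature.Geometry.Lorentzian.E3) 1 ↦
                Literature.Geometry.Lorentzian.E4.ofTimeSpace r (r • (y : Literature.Geometry.Lorentzian.E3)))
              Literature.Geometry.Lorentzian.PseudoRiemannianMetric.contMDiff_pullbackBilin_holds hf P.Lbar y = -(2 / r) := by
  intro r hr inst hf P hL hLbar y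
  haveI : smoothMetric.toPseudoRiemannianMetric.HasLeviCivita := inst
  have h1 := nullExpansion_section hr.ne' 1 hf (L := P.L)
    (fun y ↦ (hL y).trans (by rw [one_smul])) y
  have h2 := nullExpansion_section hr.ne' (-1) hf (L := P.Lbar)
    (fun y ↦ (hLbar y).trans (by rw [neg_one_smul])) y
  refine ⟨?_, ?_⟩
  · rw [mul_one] at h1
    exact h1
  · rw [show -(2 / r) = 2 * (-1) / r by ring]
    exact h2

end Summit.FinalStateConjecture.FinalStateConjecture.Theorems.BondiDrainDispersalHorizonlessMustDrain

end
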